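import Literature.AnabelianGeometry.EtaleTheta.BiKummerRootRebase

/-!
# [EtTh] §4 / Thm. 5.7: Prop. 4.2 (iv) ACROSS AN ISOMORPHISM OF PAIRS — `Ψ` transports an `N`-th root to its unit-twist up to a
# COHERENT isomorphism of root diagrams WITHOUT RE-ANCHORING (repair (r4) of FINDING F-w6d077g6-1; pp. 315, 318–320, 330 / PDF pp. 89, 92–94, 104)

S. Mochizuki, *The étale theta function and its Frobenioid-theoretic manifestations*, Publ. RIMS **45** (2009) [MochizukiEtTh2009]:
Prop. 4.2 (iv) p.315 (PDF p.89) («`ε_A : A_N^bs ⥲ A̲_N^bs` an isomorphism of `𝒟` such that `α^bs = δ^bs ∘ α̲^bs ∘ ε_A`.  Then, after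
possibly replacing `s⊓_N` by `u ∘ s⊓_N`, for some `u ∈ μ_N(B_N)` …, there exist isomorphisms `ζ_A : A_N ⥲ A̲_N`, `ζ_B : B_N ⥲ B̲_N` in `𝒞`
which fit into commutative diagrams …»; print underlines the second root, rendered by overbars `ᾱ`, `Ā_N`, … in the ASCII-bound
identifiers and glosses below); Rmk. 4.3.2 p.318–319 (PDF pp.92–93); Thm. 4.4 (ii) p.320 (PDF p.94) («`Ψ` maps `N`-th roots of
fraction-pairs with domain isomorphic to `A_{⊚,1}` to `N`-th roots of fraction-pairs with domain isomorphic to `A_{⊚,2}`»); Thm. 5.7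
proof p.330 (PDF p.104).  READING NOTES (ours, not print's words): (a) print states (iv) with `δ ∈ Aut_𝒞(A_⊚)` relating the two left
fraction-pairs and with the unit `u` on the `⊓`-component `s⊓_N`; by Def. 4.1 (i) (p.312, PDF p.86: «`s⊓ · (s⊔)⁻¹ = f`») `⊓` = `num`,
`⊔` = `den` of the tree's `FractionPair`, and this file instantiates print's clause at the SWAPPED pair — the unit sits on `pair.den`, as
in print's own §5 usage (Thm. 5.6 proof p.329, PDF p.103: «`u ∘ γ₂ ∘ s⊔ = t⊔ ∘ γ₁`»); (b) the base isomorphism is consumed "read across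
the identification `eA`", i.e. with `δ` absorbed into the anchors (`hebs` below), which is why no separate `δ^bs` factor is displayed in
the Lean statements.

abc-iut cell, layer L2; abc-iut-L2-lead (gen 4) rows **R415 / R460** (FINDING F-w6d077g6-1 booked 14:51Z, repair), seat abc-iut-w6-d077
(gen 6).  PROOF-ONLY (0 definitions; nothing landed is edited or restated).  TWIN of abc-iut-f-121's `Discharge/Sec4RootTransportTwisted.lean`
(`exists_coherent_transport_twisted`) and `BiKummerRootRebase.lean` §2 (`exists_coherent_family_member_rebase`) with two changes of
hypothesis:
* the binder `hArises` (clause (e) of Def. 4.1 (iv) for the RE-ANCHORED datum `Ψ(α′) ≫ eA`) is GONE — by F-w6d077g6-1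
  (`ThetaFrobenioidTower.not_hArises_of_obj_ne`, p453958: a base-section is a skeleton, so the re-anchored arrow can be distinguished only
  if `Ψ` fixes the codomain object on the nose) it was unmeetable for every object-moving `Ψ`; here the `Ψ`-image root is NEVER re-anchored:
  it stays abc-iut-f-121's honest image root `NthRoot.map` of the image pair `Q = Ψ(P)` (Def. 4.1 (iv) data transported STRICTLY by T44-L04b
  `PreservesBaseFrobeniusTypeData`);
* accordingly Prop. 4.2 (iv) is consumed as the clause `hivPiso` for two roots of two ISOMORPHIC pairs — `R′` a root of the pair `P′` on
  `(A, B)`, `R₂` a root of a pair `P₂` on `(A₂, B₂)`, along anchors `eA : A₂ ≅ A`, `eB : B₂ ≅ B` identifying the pairs (`eA⁻¹ ≫ s′₂ ≫ eB = s′`,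
  `eA⁻¹ ≫ s″₂ ≫ eB = s″`, `(eA)^* f′ = f₂`) and a base isomorphism `ebs : A_N^bs ≅ A_{2,N}^bs` over `(α₂ ≫ eA)^bs` (print's hypothesis «`ε_A : A_N^bs ⥲ A̲_N^bs`
  … such that `α^bs = δ^bs ∘ α̲^bs ∘ ε_A`», read across the identification `eA` — our reading: the anchors `(eA, eB)` play the part of
  print's `(δ, id_{B_⊚})`, so the displayed condition is `α^bs = ebs ≫ (α₂ ≫ eA)^bs`): `∃ u ∈ μ_N(B_N)`, `ζ_A`, `ζ_B` with the two squares, `ζ_A ≫ α₂ ≫ eA = α`,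
  `ζ_B ≫ β₂ ≫ eB = β`, `ζ_A^bs = ebs`.  For `P₂ = P′`, `eA = eB = 1` this IS abc-iut-f-121's clause `hivP′`; conversely `hivP′` gives `hivPiso` only
  through re-anchoring, i.e. through `hArises` — which is the point of stating the clause across the isomorphism.
RESULTS: `exists_zeta_transport_twisted_iso` (print's orientation `ζ_A : A_N ⥲ Ψ A_N`, `ζ_B : B_N ⥲ Ψ B_N`, `v ∈ μ_N(B_N)`, with the anchor
compatibilities and `ζ_A^bs = ebs`) and `exists_coherent_family_member_rebase_iso` (the `hfam`-member shape of abc-iut-L2-d4's anchored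
capstone — `a′ = ζ_A⁻¹`, `b′ = ζ_B⁻¹` — sharpened by the structure `w = v·ũ`, `v ∈ μ_N(B_N)`, of the discrepancy unit).
HONEST FRAMING: kernel-checked consequences of NAMED §4 inputs over abc-iut-L2-t3's law-free interface (`hivPiso` is a hypothesis binder here;
its discharge at the genuine data is the port of `Prop42Sub` L06–L08 to a pair of isomorphic pairs, a separate row); refereed pre-IUT material;
nothing here bears on [IUTchIII] Cor. 3.12 or takes a side; typed ≠ proved.
v2 (abc-iut-w6-d077 gen 7; referee finding A27-n1, doc-only): the Prop. 4.2 (iv) / Thm. 4.4 (ii) quotations re-aligned with print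
(`ε_A`, the `δ^bs` factor, the unbarred `s⊓_N`, the «with domain isomorphic to `A_{⊚,i}`» qualifier) and our swapped-pair reading moved
out of the quotation marks into READING NOTES; 0 declaration changes (every statement and proof byte-identical to v1, p457912).
-/

namespace Literature.AnabelianGeometry.EtaleTheta

open CategoryTheory Opposite Literature.AlgebraicGeometry.Frobenioids

namespace BiKummerSetting

universe u₀ v₀ u v w

variable {K : Type u₀} [Field K] {D₀ : Type u₀} [Category.{v₀} D₀] {V : FrdIMonoidStub.{w}}
  {X₁ : SemiGraphs.TemperedArithmeticGroup.{u₀} K} {T₁ : RealifiedDivisorMonoids (D₀ := D₀) V}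
  {D₁ : Type u} [Category.{v} D₁] {VD₁ : FrdICatStub.{u, v, w} D₁} {S : BiKummerSetting X₁ T₁ D₁ VD₁}

namespace NthRoot

/-! ### §1. At the twisted pair: `(R.twistUnit ũ, Ψ(R))` compared ACROSS the anchor -/

section Twisted

variable (h : Thm44Hyp S S) (ψ : ∀ A : S.C, S.biratUnits A ≃* S.biratUnits (h.Ψ.functor.obj A))
    (pullFrac : ∀ {A A' : S.C} (_ : A' ⟶ A), S.biratUnits A → S.biratUnits A')
    (hpull : ∀ {A A' : S.C} (φ : A' ⟶ A) (f : S.biratUnits A),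
      ψ A' (pullFrac φ f) = pullFrac (h.Ψ.functor.map φ) (ψ A f))
    (hii : Thm44_ii h ψ) (h3 : h.PreservesFrobeniusStructure) (h4b : h.PreservesBaseFrobeniusTypeData)
    (h8 : h.PreservesAmple) (h15a : h.PreservesFixedByHA ψ) (h15 : h.PreservesSaturated ψ)
    {A B : S.C} {f : S.biratUnits A} {P : S.FractionPair f B} {N : ℕ+} (R : S.NthRoot f P N pullFrac)
    -- the unit discrepancy at the base pair and the twisted pair
    (u : Aut B) (hu : u ∈ S.units B) {f' : S.biratUnits A}
    (hfrac : S.fracOf P.num (P.den ≫ u.hom) P.isPreStep_num (S.isPreStep_comp_aut P.isPreStep_den u)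
      (S.baseEquivalent_comp_unit P.base_eq hu) = f')
    (hdisj : S.DisjointSupports (S.div P.num) (S.div (P.den ≫ u.hom)))
    -- the normalised anchors (D_c = 1)
    (eA : h.Ψ.functor.obj A ≅ A) (eB : h.Ψ.functor.obj B ≅ B)
    (hnum : eA.inv ≫ h.Ψ.functor.map P.num ≫ eB.hom = P.num)
    (hden : eA.inv ≫ h.Ψ.functor.map P.den ≫ eB.hom = P.den ≫ u.hom)
    (hf : pullFrac eA.hom f' = ψ A f)
    -- the unit of `B_N` over `u` and its birational clauses (abc-iut-L2-d4's `hroot₁N`)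
    (ut : Aut R.BN) (hut : ut ∈ S.units R.BN) (hover : ut.hom ≫ R.β = R.β ≫ u.hom)
    {root' : S.biratUnits R.AN}
    (hfracN : S.fracOf R.pair.num (R.pair.den ≫ ut.hom) R.pair.isPreStep_num
      (S.isPreStep_comp_aut R.pair.isPreStep_den ut) (S.baseEquivalent_comp_unit R.pair.base_eq hut) = root')
    (hdisjN : S.DisjointSupports (S.div R.pair.num) (S.div (R.pair.den ≫ ut.hom)))
    (hpow : root' ^ (N : ℕ) = pullFrac R.αData.α₁ f')
    (hsat : S.IsSaturated R.AN N (pullFrac R.αData.α₁ f'))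
    -- Prop 4.2 (iv) at the twisted pair, ACROSS an isomorphism of pairs
    (hivPiso : ∀ {A₂ B₂ : S.C} {f₂ : S.biratUnits A₂} {P₂ : S.FractionPair f₂ B₂}
      (R' : S.NthRoot f' (P.twistUnit u hu hfrac hdisj) N pullFrac) (R₂ : S.NthRoot f₂ P₂ N pullFrac)
      (eA : A₂ ≅ A) (eB : B₂ ≅ B),
      eA.inv ≫ P₂.num ≫ eB.hom = P.num → eA.inv ≫ P₂.den ≫ eB.hom = P.den ≫ u.hom → pullFrac eA.hom f' = f₂ →
      ∀ (ebs : S.base.obj R'.AN ≅ S.base.obj R₂.AN), S.base.map R'.α = ebs.hom ≫ S.base.map (R₂.α ≫ eA.hom) →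
        ∃ (v : S.mu R'.BN N) (ζA : R'.AN ≅ R₂.AN) (ζB : R'.BN ≅ R₂.BN),
          ζA.hom ≫ R₂.pair.num = R'.pair.num ≫ ζB.hom ∧
          ζA.hom ≫ R₂.pair.den = (R'.pair.den ≫ (v : Aut R'.BN).hom) ≫ ζB.hom ∧
          ζA.hom ≫ R₂.α ≫ eA.hom = R'.α ∧ ζB.hom ≫ R₂.β ≫ eB.hom = R'.β ∧ S.base.mapIso ζA = ebs)
    (ebs : S.base.obj R.AN ≅ S.base.obj (h.Ψ.functor.obj R.AN))
    (hebs : S.base.map R.α = ebs.hom ≫ S.base.map (h.Ψ.functor.map R.α ≫ eA.hom))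

include hpull hii h3 h4b h8 h15a h15 hnum hden hf hover hfracN hdisjN hpow hsat hivPiso hebs in
/-- **Prop 4.2 (iv) across the anchor, applied to `(R.twistUnit ũ, Ψ(R))` — NO re-anchoring, NO clause-(e) binder**, in print's
orientation (`ζ_A : A_N ⥲ Ā_N`, `ζ_B : B_N ⥲ B̄_N`, p.315): `Ψ(R)` is abc-iut-f-121's image root `R.map` of the image pair `Q = (Ψ s′, Ψ s″)`
(T44-L13/L04b), compared with the `ũ`-twist of `R` across `(eA, eB)`: `∃ v ∈ μ_N(B_N)`, `ζ_A : A_N ≅ Ψ A_N`, `ζ_B : B_N ≅ Ψ B_N` with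
`ζ_A ≫ Ψ s′_N = s′_N ≫ ζ_B`, `ζ_A ≫ Ψ s″_N = ((s″_N ≫ ũ) ≫ v) ≫ ζ_B`, `ζ_A ≫ Ψ α ≫ eA = α`, `ζ_B ≫ Ψ β ≫ eB = β`, `ζ_A^bs = ebs`.
[cite: MochizukiEtTh2009, Prop 4.2 (iv) p.315 (PDF p.89); Thm 4.4 (ii) p.320 (PDF p.94); Rmk 4.3.2 p.318–319 (PDF pp.92–93)] -/
theorem exists_zeta_transport_twisted_iso :
    ∃ (v : S.mu R.BN N) (ζA : R.AN ≅ h.Ψ.functor.obj R.AN) (ζB : R.BN ≅ h.Ψ.functor.obj R.BN),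
      ζA.hom ≫ h.Ψ.functor.map R.pair.num = R.pair.num ≫ ζB.hom ∧
      ζA.hom ≫ h.Ψ.functor.map R.pair.den = ((R.pair.den ≫ ut.hom) ≫ (v : Aut R.BN).hom) ≫ ζB.hom ∧
      ζA.hom ≫ h.Ψ.functor.map R.α ≫ eA.hom = R.α ∧ ζB.hom ≫ h.Ψ.functor.map R.β ≫ eB.hom = R.β ∧
      S.base.mapIso ζA = ebs := by
  -- the image pair `Q = (Ψ s′, Ψ s″)` of `ψ f` on `(Ψ A, Ψ B)` ("`Ψ` preserves fraction-pairs", T44-L13)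
  obtain ⟨Q, hQn, hQd⟩ := hii f P
  -- the anchor identifies `Q` with the twisted pair `(s′, u ∘ s″)`
  have hnum' : eA.inv ≫ Q.num ≫ eB.hom = P.num := by rw [hQn]; exact hnum
  have hden' : eA.inv ≫ Q.den ≫ eB.hom = P.den ≫ u.hom := by rw [hQd]; exact hden
  -- compare the twist of `R` with the HONEST image root `Ψ(R)` of `Q`
  have hebs' : S.base.map (R.twistUnit u hu hfrac hdisj ut hut hover hfracN hdisjN hpow hsat).α =
      ebs.hom ≫ S.base.map ((R.map h ψ pullFrac hpull hii h3 h4b h8 h15a h15 Q hQn hQd).α ≫ eA.hom) := by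
    rw [twistUnit_α, map_α]; exact hebs
  obtain ⟨v, ζA, ζB, h₁, h₂, h₃, h₄, h₅⟩ := hivPiso
    (R.twistUnit u hu hfrac hdisj ut hut hover hfracN hdisjN hpow hsat)
    (R.map h ψ pullFrac hpull hii h3 h4b h8 h15a h15 Q hQn hQd) eA eB hnum' hden' hf ebs hebs'
  rw [map_pair_num, twistUnit_pair_num] at h₁
  rw [map_pair_den, twistUnit_pair_den] at h₂
  rw [map_α, twistUnit_α] at h₃
  rw [map_β, twistUnit_β] at h₄
  exact ⟨v, ζA, ζB, h₁, h₂, h₃, h₄, h₅⟩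

end Twisted

/-! ### §2. At the twisted LEVEL-1 pair, applied to the rebased root (abc-iut-f-121's `NthRoot.rebase`) -/

section Rebase

variable (h : Thm44Hyp S S) (ψ : ∀ A : S.C, S.biratUnits A ≃* S.biratUnits (h.Ψ.functor.obj A))
    (pullFrac : ∀ {A A' : S.C} (_ : A' ⟶ A), S.biratUnits A → S.biratUnits A')
    (hpull : ∀ {A A' : S.C} (φ : A' ⟶ A) (f : S.biratUnits A),
      ψ A' (pullFrac φ f) = pullFrac (h.Ψ.functor.map φ) (ψ A f))
    (hii : Thm44_ii h ψ) (h3 : h.PreservesFrobeniusStructure) (h4b : h.PreservesBaseFrobeniusTypeData)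
    (h8 : h.PreservesAmple) (h15a : h.PreservesFixedByHA ψ) (h15 : h.PreservesSaturated ψ)
    {A B : S.C} {f : S.biratUnits A} {P : S.FractionPair f B} {N : ℕ+}
    -- the level-`N` root, the level-`1` root and the transition (inputs of `rebase`)
    (R : S.NthRoot f P N pullFrac) (R₁ : S.NthRoot f P 1 pullFrac)
    (a : R.AN ⟶ R₁.AN) (b : R.BN ⟶ R₁.BN)
    (comm_num : R.pair.num ≫ b = a ≫ R₁.pair.num) (comm_den : R.pair.den ≫ b = a ≫ R₁.pair.den)
    (ha : S.IsIsometry a) (hb : S.IsIsometry b) (hdega : S.degFr a = N) (hdegb : S.degFr b = N)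
    (D : S.BaseFrobeniusTypeData a) (hD : pullFrac D.α₁ R₁.root = pullFrac R.αData.α₁ f)
    -- the unit discrepancy at the LEVEL-1 pair and the twisted level-1 pair
    (u : Aut R₁.BN) (hu : u ∈ S.units R₁.BN) {f' : S.biratUnits R₁.AN}
    (hfrac : S.fracOf R₁.pair.num (R₁.pair.den ≫ u.hom) R₁.pair.isPreStep_num
      (S.isPreStep_comp_aut R₁.pair.isPreStep_den u) (S.baseEquivalent_comp_unit R₁.pair.base_eq hu) = f')
    (hdisj : S.DisjointSupports (S.div R₁.pair.num) (S.div (R₁.pair.den ≫ u.hom)))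
    -- the normalised level-1 anchor `(eA, eB) = (α_1, β_1)` (`D_c = 1`, unit `u = u_1`)
    (eA : h.Ψ.functor.obj R₁.AN ≅ R₁.AN) (eB : h.Ψ.functor.obj R₁.BN ≅ R₁.BN)
    (hnum : eA.inv ≫ h.Ψ.functor.map R₁.pair.num ≫ eB.hom = R₁.pair.num)
    (hden : eA.inv ≫ h.Ψ.functor.map R₁.pair.den ≫ eB.hom = R₁.pair.den ≫ u.hom)
    (hf : pullFrac eA.hom f' = ψ R₁.AN R₁.root)
    -- the unit of `B_N` over `u` along the transition `β_{1,N}` and its birational clauses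
    (ut : Aut R.BN) (hut : ut ∈ S.units R.BN) (hover : ut.hom ≫ b = b ≫ u.hom)
    {root' : S.biratUnits R.AN}
    (hfracN : S.fracOf R.pair.num (R.pair.den ≫ ut.hom) R.pair.isPreStep_num
      (S.isPreStep_comp_aut R.pair.isPreStep_den ut) (S.baseEquivalent_comp_unit R.pair.base_eq hut) = root')
    (hdisjN : S.DisjointSupports (S.div R.pair.num) (S.div (R.pair.den ≫ ut.hom)))
    (hpow : root' ^ (N : ℕ) = pullFrac D.α₁ f')
    (hsat : S.IsSaturated R.AN N (pullFrac D.α₁ f'))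
    -- Prop 4.2 (iv) at the twisted level-1 pair, ACROSS an isomorphism of pairs
    (hivPiso : ∀ {A₂ B₂ : S.C} {f₂ : S.biratUnits A₂} {P₂ : S.FractionPair f₂ B₂}
      (R' : S.NthRoot f' (R₁.pair.twistUnit u hu hfrac hdisj) N pullFrac) (R₂ : S.NthRoot f₂ P₂ N pullFrac)
      (eA : A₂ ≅ R₁.AN) (eB : B₂ ≅ R₁.BN),
      eA.inv ≫ P₂.num ≫ eB.hom = R₁.pair.num → eA.inv ≫ P₂.den ≫ eB.hom = R₁.pair.den ≫ u.hom → pullFrac eA.hom f' = f₂ →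
      ∀ (ebs : S.base.obj R'.AN ≅ S.base.obj R₂.AN), S.base.map R'.α = ebs.hom ≫ S.base.map (R₂.α ≫ eA.hom) →
        ∃ (v : S.mu R'.BN N) (ζA : R'.AN ≅ R₂.AN) (ζB : R'.BN ≅ R₂.BN),
          ζA.hom ≫ R₂.pair.num = R'.pair.num ≫ ζB.hom ∧
          ζA.hom ≫ R₂.pair.den = (R'.pair.den ≫ (v : Aut R'.BN).hom) ≫ ζB.hom ∧
          ζA.hom ≫ R₂.α ≫ eA.hom = R'.α ∧ ζB.hom ≫ R₂.β ≫ eB.hom = R'.β ∧ S.base.mapIso ζA = ebs)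
    (ebs : S.base.obj R.AN ≅ S.base.obj (h.Ψ.functor.obj R.AN))
    (hebs : S.base.map a = ebs.hom ≫ S.base.map (h.Ψ.functor.map a ≫ eA.hom))

include hpull hii h3 h4b h8 h15a h15 comm_num comm_den ha hb hdega hdegb hD hnum hden hf hover hfracN hdisjN hpow hsat hivPiso hebs in
/-- **The level-`N` member of the coherent family at the rebased root `R̃_N`, WITHOUT `hArises`, WITH the structure of the discrepancy unit**
(twin of abc-iut-f-121's `exists_coherent_family_member_rebase`, sharper conclusion): `∃ (a′ : Ψ A_N ≅ A_N) (b′ : Ψ B_N ≅ B_N) (w ∈ O^×(B_N))`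
with `w = v·ũ` for some `v ∈ μ_N(B_N)` (print, p.315: «after possibly replacing `s⊓_N` by `u ∘ s⊓_N`, for some `u ∈ μ_N(B_N)`» —
instantiated here at the swapped pair, i.e. with the root of unity on the `den` component, see the module docstring), `a′⁻¹ ≫ Ψ s′_N ≫ b′ = s′_N`,
`a′⁻¹ ≫ Ψ s″_N ≫ b′ = s″_N ≫ w`, `a′⁻¹ ≫ Ψ α_{1,N} ≫ eA = α_{1,N}`, `b′⁻¹ ≫ Ψ β_{1,N} ≫ eB = β_{1,N}` — from `exists_zeta_transport_twisted_iso`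
at `R.rebase R₁ …` with `a′ := ζ_A⁻¹`, `b′ := ζ_B⁻¹`.
[cite: MochizukiEtTh2009, Thm 5.7 p.330 (PDF p.104); Rmk 4.3.2 p.318–319 (PDF pp.92–93); Prop 4.2 (iv) p.315 (PDF p.89)] -/
theorem exists_coherent_family_member_rebase_iso :
    ∃ (a' : h.Ψ.functor.obj R.AN ≅ R.AN) (b' : h.Ψ.functor.obj R.BN ≅ R.BN) (w : Aut R.BN),
      w ∈ S.units R.BN ∧ (∃ v ∈ S.mu R.BN N, w = v * ut) ∧
      a'.inv ≫ h.Ψ.functor.map R.pair.num ≫ b'.hom = R.pair.num ∧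
      a'.inv ≫ h.Ψ.functor.map R.pair.den ≫ b'.hom = R.pair.den ≫ w.hom ∧
      a'.inv ≫ h.Ψ.functor.map a ≫ eA.hom = a ∧ b'.inv ≫ h.Ψ.functor.map b ≫ eB.hom = b := by
  obtain ⟨⟨v, hv⟩, ζA, ζB, h₁, h₂, h₃, h₄, -⟩ := exists_zeta_transport_twisted_iso h ψ pullFrac hpull hii h3 h4b h8 h15a h15
    (R.rebase R₁ a b comm_num comm_den ha hb hdega hdegb D hD) u hu hfrac hdisj eA eB hnum hden hf
    ut hut hover hfracN hdisjN hpow hsat hivPiso ebs hebs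
  change Aut R.BN at v
  change v ∈ S.mu R.BN N at hv
  have h₁' : (ζA.hom : R.AN ⟶ h.Ψ.functor.obj R.AN) ≫ h.Ψ.functor.map R.pair.num =
      R.pair.num ≫ (ζB.hom : R.BN ⟶ h.Ψ.functor.obj R.BN) := h₁
  have h₂' : (ζA.hom : R.AN ⟶ h.Ψ.functor.obj R.AN) ≫ h.Ψ.functor.map R.pair.den =
      ((R.pair.den ≫ ut.hom) ≫ v.hom) ≫ (ζB.hom : R.BN ⟶ h.Ψ.functor.obj R.BN) := h₂
  have h₃' : (ζA.hom : R.AN ⟶ h.Ψ.functor.obj R.AN) ≫ h.Ψ.functor.map a ≫ eA.hom = a := h₃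
  have h₄' : (ζB.hom : R.BN ⟶ h.Ψ.functor.obj R.BN) ≫ h.Ψ.functor.map b ≫ eB.hom = b := h₄
  refine ⟨(ζA : R.AN ≅ h.Ψ.functor.obj R.AN).symm, (ζB : R.BN ≅ h.Ψ.functor.obj R.BN).symm, v * ut,
    (S.units R.BN).mul_mem hv.1 hut, ⟨v, hv, rfl⟩, ?_, ?_, ?_, ?_⟩
  · rw [Iso.symm_inv, Iso.symm_hom, ← Category.assoc]
    exact (Iso.comp_inv_eq _).mpr h₁'
  · rw [Iso.symm_inv, Iso.symm_hom, ← Category.assoc, Aut.Aut_mul_def, Iso.trans_hom, ← Category.assoc]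
    exact (Iso.comp_inv_eq _).mpr h₂'
  · rw [Iso.symm_inv]; exact h₃'
  · rw [Iso.symm_inv]; exact h₄'

end Rebase

end NthRoot

end BiKummerSetting

end Literature.AnabelianGeometry.EtaleTheta
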